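import Summits.QuantumAdvantage.QuantumAdvantage.Theorems.CubicForrelationNearExactIsExactTwelveTypeOShape2932

/-!
# Crux `CubicForrelation.NearExactIsExact` (stmt-QuantumAdvantage-14043) — n = 12, type O with the 9-flat base set `512` at `Φ ≥ 29/32`:
  either `Φ ≥ 929/1024` (dead there by …TypeO512At929), or `Φ = 29/32` EXACTLY with `256` wild points `v = ±1` inside `E`; in particular
  the 9-flat pattern is dead in the OPEN window `29/32 < Φ < 929/1024`

Certificate seat `b2b-cforr-cert` (gen 22).  HONEST FRAMING: a kernel-checked dichotomy (standard axioms, no `decide`) about cubic Boolean pairs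
on 12 bits — the base-`512` configuration of the boundary rung `29/32 = 928/1024` on the `n = 12` ladder (HOME/b2b-cforr-cert-g20/PLAN-N12-928.md).
NO new value of `θ₁₂` by itself.  NOT summit progress.

For a type-O side (`W_g = 16u`, every `u` odd) with `#E = 512` (`E = {d₁ = d₂}` a 9-flat) write `u − 4(−1)^f = τ₀ + 8v`, excess
`X = Σ((τ₀ + 8v)² − τ₀²) = 2¹⁷(1 − Φ) − 8192 ≤ 4096` at `Φ ≥ 29/32`.
* `to22_typeO_E512_ge2932_dichotomy`: the relative tower of gen 15/19 (`to12_cube_congr`, `to12_level`): if `v` is even everywhere then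
  `v ∈ 8ℤ` (the levels `2`, `3` cost `≥ 160·64`, `≥ 832·8`), a wild point costs `≥ 3712`, two cost too much, none would give `Φ = 15/16`;
  the single wild point has `v = ±8` and `X ∈ {3712, 3968}` (`4224, 4480 > 4096`), i.e. `Φ ∈ {931/1024, 929/1024}`, so `Φ ≥ 929/1024`.
  Otherwise the odd set of `v` has `≥ 256` points (Reed–Muller at level `1`), each costing `≥ 16`: `X = 4096`, `Φ = 29/32`, exactly `256`
  wild points, all with `v = ±1`, `τ₀ = −3v` (so inside `E`, `τ = ±5`), and `v = 0` elsewhere.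
* `to22_typeO_E512_lt929_false`: hence no type-O side with `#E = 512` at `29/32 < Φ < 929/1024`;
  `to22_typeO_E512_gt2932_false`: none at any `Φ > 29/32` (with `to20_typeO_E512_ge929_false`).

References: Kasami–Tokura (1970); MacWilliams–Sloane (1977) Ch. 13–15; O'Donnell (2014) §1.4.  Axioms: the standard three.
-/

set_option linter.dupNamespace false -- D-0017: single-problem summit ⇒ `QuantumAdvantage.QuantumAdvantage` by design

noncomputable section

namespace Summit.QuantumAdvantage.QuantumAdvantage.Theorems.CubicForrelation.NearExactIsExact

open Finset
open Literature.Computability.QuantumComplexity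
open Literature.Computability.QuantumComplexity.BuzetChailloux (bxor zeroVec bxor_bxor_cancel_left bxor_zeroVec zeroVec_bxor bxor_comm
  bxor_self twist_zeroVec_right twist_bxor_right signOf_sq sum_twist_left)
open Literature.Computability.QuantumComplexity.DerivativeWalsh (W sum_W_sq)
open Literature.Computability.QuantumComplexity.Simon (twist_eq_one_or)
open Summit.QuantumAdvantage.QuantumAdvantage.Theorems.NearExactIsExact.Negative (TypeOTwelve.no_caseA TypeOTwelve.cube_sum_dvd
  TypeOTwelve.typeO_of_exists_odd)
open Summit.QuantumAdvantage.QuantumAdvantage.Theorems.SignedCubicForrelationNotPrBPP (knf_isDegLeFun_ip)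

/-! ### The 9-flat base pattern at `Φ ≥ 29/32`: the dichotomy -/

/-- **Type O, `#E = 512`, `Φ ≥ 29/32` on 12 bits: either `Φ ≥ 929/1024`, or `Φ = 29/32` with exactly `256` wild points, all of height
`v = ±1` with `τ₀ = −3v`, and `v = 0` elsewhere.**  See the module docstring.  Finite-slice statement; NOT summit progress. [this work] -/
theorem to22_typeO_E512_ge2932_dichotomy (f g : (Fin (6 + 6) → Bool) → Bool) (hf : IsDegLeFun 3 f) (hg : IsDegLeFun 3 g)
    (u : (Fin (6 + 6) → Bool) → ℤ) (hu : ∀ x, W (fun y => signOf (g y)) x = (2 : ℝ) ^ 4 * (u x : ℝ))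
    (hodd : ∃ x, Odd (u x)) (hE512 : #(univ.filter fun x : Fin (6 + 6) → Bool => (Odd (u x / 2) ↔ Odd (u x / 2 / 2))) = 512)
    (hΦ : (29 / 32 : ℝ) ≤ forrelation f g) :
    (929 / 1024 : ℝ) ≤ forrelation f g ∨
    (forrelation f g = 29 / 32 ∧ ∃ v : (Fin (6 + 6) → Bool) → ℤ,
      (∀ x, u x - 4 * sZ (f x) =
        sZ (decide (Odd (u x / 2))) * (1 - 4 * (if (Odd (u x / 2) ↔ Odd (u x / 2 / 2)) then 1 else 0)) + 8 * v x) ∧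
      (∀ x, v x = 0 ∨ ((v x = 1 ∨ v x = -1) ∧
        sZ (decide (Odd (u x / 2))) * (1 - 4 * (if (Odd (u x / 2) ↔ Odd (u x / 2 / 2)) then 1 else 0)) = -3 * v x)) ∧
      #(univ.filter fun x => v x ≠ 0) = 256) := by
  classical
  have hΦle : forrelation f g ≤ 59 / 64 := to12_typeO_le f g hf hg u hu hodd
  have hall : ∀ x, Odd (u x) := TypeOTwelve.typeO_of_exists_odd g u hg hu hodd
  have hu' : ∀ x, W (fun y => signOf (g y)) x = (2 : ℝ) ^ (2 * 2) * (u x : ℝ) := fun x => (hu x).trans (by norm_num)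
  have hd1 : IsDegLeFun 1 (fun x => decide (Odd (u x / 2))) := z2_digitOne 2 g u hg hu' hall
  have hd2 : IsDegLeFun 3 (fun x => decide (Odd (u x / 2 / 2))) := z2_digitTwo 2 g u hg hu' hall
  set E := univ.filter (fun x : Fin (6 + 6) → Bool => (Odd (u x / 2) ↔ Odd (u x / 2 / 2))) with hEdef
  have hmemE : ∀ x, x ∈ E ↔ (Odd (u x / 2) ↔ Odd (u x / 2 / 2)) := fun x => by simp [hEdef]
  have hdegE : IsDegLeFun (2 + 1) (fun x => (decide (Odd (u x / 2)) ^^ decide (Odd (u x / 2 / 2))) ^^ true) :=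
    tb_isDegLeFun_xor_const (bb_isDegLeFun_bxor (hd1.mono (by norm_num)) hd2) true
  have hsetE : (univ.filter fun x : Fin (6 + 6) → Bool =>
      ((decide (Odd (u x / 2)) ^^ decide (Odd (u x / 2 / 2))) ^^ true) = true) = E := by
    rw [hEdef]
    apply filter_congr
    intro x _
    by_cases h1 : Odd (u x / 2) <;> by_cases h2 : Odd (u x / 2 / 2) <;> simp [h1, h2]
  have hsumE : (∑ x, (if (Odd (u x / 2) ↔ Odd (u x / 2 / 2)) then 1 else 0 : ℤ)) = #E := by rw [sum_boole]
  -- budget `Σ τ² = 2¹⁷(1 − Φ) ≤ 12288`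
  have hbud := tw12_budget f g u hu
  have hT : (∑ x, (u x - 4 * sZ (f x)) ^ 2 : ℤ) ≤ 12288 := by
    have h' : ((∑ x, (u x - 4 * sZ (f x)) ^ 2 : ℤ) : ℝ) ≤ 12288 := by rw [hbud]; linarith
    exact_mod_cast h'
  -- base pattern `τ₀` and wild function `v`: `τ = τ₀ + 8v`
  choose v hv using fun x => to12_pt_mod8 (u x) (sZ (f x)) (hall x) (tp_sZ_cases (f x))
  set τ₀ : (Fin (6 + 6) → Bool) → ℤ := fun x =>
    sZ (decide (Odd (u x / 2))) * (1 - 4 * (if (Odd (u x / 2) ↔ Odd (u x / 2 / 2)) then 1 else 0)) with hτ₀def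
  have hvx : ∀ x, u x - 4 * sZ (f x) = τ₀ x + 8 * v x := fun x => hv x
  have hτ₀val : ∀ x, τ₀ x = 1 ∨ τ₀ x = -1 ∨ τ₀ x = 3 ∨ τ₀ x = -3 := by
    intro x
    simp only [τ₀]
    rcases tp_sZ_cases (decide (Odd (u x / 2))) with h | h <;> rw [h] <;> split_ifs <;> norm_num
  have hτ₀sq : ∀ x, τ₀ x ^ 2 = 1 + 8 * (if (Odd (u x / 2) ↔ Odd (u x / 2 / 2)) then 1 else 0 : ℤ) := by
    intro x
    simp only [τ₀]
    rcases tp_sZ_cases (decide (Odd (u x / 2))) with h | h <;> rw [h] <;> split_ifs <;> norm_num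
  have hsumτ₀ : ∑ x, τ₀ x ^ 2 = 4096 + 8 * #E := by
    rw [sum_congr rfl fun x _ => hτ₀sq x, sum_add_distrib, ← mul_sum, hsumE, sum_const, card_univ, Fintype.card_fun,
      Fintype.card_bool, Fintype.card_fin]
    norm_num
  -- excess decomposition `Σ τ² = Σ τ₀² + Σ X`, `X ≥ 0`
  set X : (Fin (6 + 6) → Bool) → ℤ := fun x => (τ₀ x + 8 * v x) ^ 2 - τ₀ x ^ 2 with hXdef
  have hXnn : ∀ x, 0 ≤ X x := fun x => to12_excess_nonneg _ _ (hτ₀val x)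
  have hTdec : (∑ x, (u x - 4 * sZ (f x)) ^ 2 : ℤ) = ∑ x, τ₀ x ^ 2 + ∑ x, X x := by
    rw [← sum_add_distrib]
    exact sum_congr rfl fun x _ => by rw [hvx x]; simp only [X]; ring
  have hTX : (∑ x, (u x - 4 * sZ (f x)) ^ 2 : ℤ) = 8192 + ∑ x, X x := by rw [hTdec, hsumτ₀, hE512]; norm_num
  have hXsum : ∑ x, X x ≤ 4096 := by linarith
  -- `E` is a 9-flat
  have hmwE := mw_flat_of_minweight 2 _ hdegE (by rw [hsetE, hE512]; norm_num)
  rw [hsetE] at hmwE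
  obtain ⟨h0E, haddE, hcardVE, hcosetE⟩ := hmwE
  set VE := univ.filter (fun a : Fin (6 + 6) → Bool => ∀ x,
    ((decide (Odd (u (bxor x a) / 2)) ^^ decide (Odd (u (bxor x a) / 2 / 2))) ^^ true) =
      ((decide (Odd (u x / 2)) ^^ decide (Odd (u x / 2 / 2))) ^^ true)) with hVE
  rw [hE512] at hcardVE
  have hEpos : 0 < #E := by rw [hE512]; norm_num
  obtain ⟨xE, hxE⟩ : E.Nonempty := card_pos.1 hEpos
  have hSE : E = VE.image (bxor xE) := hcosetE xE (by
    have h := (hmemE xE).1 hxE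
    by_cases h1 : Odd (u xE / 2)
    · have h2 : Odd (u xE / 2 / 2) := h.1 h1
      simp [h1, h2]
    · have h2 : ¬ Odd (u xE / 2 / 2) := fun h' => h1 (h.2 h')
      simp [h1, h2])
  -- the wild identity in coset form
  have hv' : ∀ x, u x - 4 * sZ (f x) =
      sZ (decide (Odd (u x / 2))) * (1 - 4 * (if x ∈ VE.image (bxor xE) then 1 else 0)) + 8 * v x := by
    intro x
    rw [← hSE, hvx x]
    simp only [τ₀]
    by_cases hx : (Odd (u x / 2) ↔ Odd (u x / 2 / 2))
    · rw [if_pos hx, if_pos ((hmemE x).2 hx)]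
    · rw [if_neg hx, if_neg (fun h' => hx ((hmemE x).1 h'))]
  have hcc := fun I => to12_cube_congr f g hf hg u hu hd1 VE xE h0E haddE hcardVE v hv' I
  -- excess of a set of wild points
  have hXset : ∀ (S : Finset (Fin (6 + 6) → Bool)) (c : ℤ), 1 ≤ c → (∀ x ∈ S, c ≤ v x ∨ v x ≤ -c) →
      16 * c * (4 * c - 3) * #S ≤ ∑ x ∈ S, X x := by
    intro S c hc hS
    calc 16 * c * (4 * c - 3) * #S = ∑ x ∈ S, 16 * c * (4 * c - 3) := by rw [sum_const, nsmul_eq_mul, mul_comm]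
      _ ≤ ∑ x ∈ S, X x := sum_le_sum fun x hx => to12_excess _ _ c (hτ₀val x) hc (hS x hx)
  have hXsub : ∀ (S : Finset (Fin (6 + 6) → Bool)), ∑ x ∈ S, X x ≤ ∑ x, X x := fun S =>
    sum_le_sum_of_subset_of_nonneg (subset_univ _) fun x _ _ => hXnn x
  -- LEVEL 1: `v` is even, OR the odd set of `v` has `≥ 256` points (the boundary configuration)
  rcases to12_level v 4 (fun I hI => (hcc I).1 (by omega)) with hv2 | hbig
  · /- `v` even everywhere: the levels collapse as in gen 19, one wild point of height `±8`, `Φ ∈ {931, 929}/1024` -/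
    left
    choose v₁ hv₁ using hv2
    have hvv₁ : ∀ x, v x = 2 * v₁ x := fun x => by rw [two_mul]; exact hv₁ x
    -- LEVEL 2: `v/2` is even
    have hv4 : ∀ x, Even (v₁ x) := by
      rcases to12_level v₁ 6 (fun I hI => by
        have h4 := (hcc I).2.1 (by omega)
        rw [sum_congr rfl (fun x _ => hvv₁ x), ← mul_sum] at h4
        omega) with h | h
      · exact h
      · exfalso
        have hcnt : (64 : ℤ) ≤ #(univ.filter fun x => Odd (v₁ x)) := by norm_num at h; exact_mod_cast (by omega)
        have hge := hXset (univ.filter fun x => Odd (v₁ x)) 2 (by norm_num) (fun x hx => by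
          obtain ⟨k, hk⟩ := (mem_filter.1 hx).2; have := hvv₁ x; omega)
        have := hXsub (univ.filter fun x => Odd (v₁ x))
        linarith
    choose v₂ hv₂ using hv4
    have hvv₂ : ∀ x, v x = 4 * v₂ x := fun x => by rw [hvv₁ x, hv₂ x]; ring
    -- LEVEL 3: `v/4` is even
    have hv8 : ∀ x, Even (v₂ x) := by
      rcases to12_level v₂ 9 (fun I hI => by
        have h8 := (hcc I).2.2 (by omega)
        rw [sum_congr rfl (fun x _ => hvv₂ x), ← mul_sum] at h8
        omega) with h | h
      · exact h
      · exfalso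
        have hcnt : (8 : ℤ) ≤ #(univ.filter fun x => Odd (v₂ x)) := by norm_num at h; exact_mod_cast (by omega)
        have hge := hXset (univ.filter fun x => Odd (v₂ x)) 4 (by norm_num) (fun x hx => by
          obtain ⟨k, hk⟩ := (mem_filter.1 hx).2; have := hvv₂ x; omega)
        have := hXsub (univ.filter fun x => Odd (v₂ x))
        linarith
    -- LEVEL 4: a wild point costs `≥ 3712`; two are too many, none gives `Φ = 15/16`
    have hX8 : ∀ x, v x ≠ 0 → 3712 ≤ X x := by
      intro x hx
      have h8 : 8 ≤ v x ∨ v x ≤ -8 := by obtain ⟨k, hk⟩ := hv8 x; have := hvv₂ x; omega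
      have h1 := to12_excess _ _ 8 (hτ₀val x) (by norm_num) h8
      simp only [X]; linarith
    have hsome : ∃ x₀, v x₀ ≠ 0 := by
      by_contra hnone
      push Not at hnone
      have hT8192 : (∑ x, (u x - 4 * sZ (f x)) ^ 2 : ℤ) = 8192 := by
        rw [hTdec, hsumτ₀, hE512, sum_eq_zero (fun x _ => by simp only [X]; rw [hnone x]; ring)]
        norm_num
      have hΦeq : forrelation f g = 15 / 16 := by
        have h : ((∑ x, (u x - 4 * sZ (f x)) ^ 2 : ℤ) : ℝ) = 8192 := by exact_mod_cast hT8192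
        rw [hbud] at h
        linarith
      rw [hΦeq] at hΦle
      norm_num at hΦle
    obtain ⟨x₀, hx₀⟩ := hsome
    have hothers : ∀ x, x ≠ x₀ → v x = 0 := by
      intro x hx
      by_contra hvx0
      have h2 : X x + X x₀ ≤ ∑ y, X y := by
        rw [← sum_pair hx]
        exact sum_le_sum_of_subset_of_nonneg (subset_univ _) fun y _ _ => hXnn y
      linarith [hX8 x hvx0, hX8 x₀ hx₀]
    have hv16 : v x₀ = 8 ∨ v x₀ = -8 := by
      by_contra hcon
      have h16 : 16 ≤ v x₀ ∨ v x₀ ≤ -16 := by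
        obtain ⟨k, hk⟩ := hv8 x₀; have := hvv₂ x₀; omega
      have h1 := to12_excess _ _ 16 (hτ₀val x₀) (by norm_num) h16
      have h2 : X x₀ ≤ ∑ y, X y := single_le_sum (fun y _ => hXnn y) (mem_univ x₀)
      simp only [X] at h2
      linarith
    -- the single wild point costs `3712` or `3968` (the costs `4224`, `4480` exceed the budget)
    have hXx₀ : ∑ y, X y = X x₀ := by
      rw [← Finset.sum_erase_add _ _ (mem_univ x₀), sum_eq_zero fun y hy => ?_, zero_add]
      simp only [X]; rw [hothers y (ne_of_mem_erase hy)]; ring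
    have hXval : X x₀ = 3712 ∨ X x₀ = 3968 := by
      have hle : X x₀ ≤ 4096 := by rw [← hXx₀]; exact hXsum
      simp only [X] at hle ⊢
      rcases hv16 with h8 | h8 <;> rw [h8] at hle ⊢ <;> rcases hτ₀val x₀ with h | h | h | h <;> rw [h] at hle ⊢ <;>
        norm_num at hle <;> norm_num
    rcases hXval with h3712 | h3968
    · have hT11904 : (∑ x, (u x - 4 * sZ (f x)) ^ 2 : ℤ) = 11904 := by rw [hTX, hXx₀, h3712]; norm_num
      have h : ((∑ x, (u x - 4 * sZ (f x)) ^ 2 : ℤ) : ℝ) = 11904 := by exact_mod_cast hT11904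
      rw [hbud] at h
      linarith
    · have hT12160 : (∑ x, (u x - 4 * sZ (f x)) ^ 2 : ℤ) = 12160 := by rw [hTX, hXx₀, h3968]; norm_num
      have h : ((∑ x, (u x - 4 * sZ (f x)) ^ 2 : ℤ) : ℝ) = 12160 := by exact_mod_cast hT12160
      rw [hbud] at h
      linarith
  · /- the odd set of `v` has `≥ 256` points, each costing `≥ 16`: the budget is exhausted EXACTLY -/
    right
    set S := univ.filter (fun x : Fin (6 + 6) → Bool => Odd (v x)) with hSdef
    have hScard : 256 ≤ #S := by norm_num at hbig; omega
    have hS16 : ∀ x ∈ S, 16 ≤ X x := by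
      intro x hx
      have h1 : 1 ≤ v x ∨ v x ≤ -1 := by obtain ⟨k, hk⟩ := (mem_filter.1 hx).2; omega
      have := to12_excess _ _ 1 (hτ₀val x) le_rfl h1
      simp only [X]; linarith
    have hSsum : 16 * (#S : ℤ) ≤ ∑ x ∈ S, X x := by
      have h := hXset S 1 le_rfl (fun x hx => by obtain ⟨k, hk⟩ := (mem_filter.1 hx).2; omega)
      linarith
    have hSsub := hXsub S
    have hScast : (256 : ℤ) ≤ #S := by exact_mod_cast hScard
    -- so `Σ X = 4096`, `#S = 256`, `Σ_S X = 4096`, and every `X` off `S` vanishes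
    have hXeq : ∑ x, X x = 4096 := le_antisymm hXsum (by linarith)
    have hΦeq : forrelation f g = 29 / 32 := by
      have hT12288 : (∑ x, (u x - 4 * sZ (f x)) ^ 2 : ℤ) = 12288 := by rw [hTX, hXeq]; norm_num
      have h : ((∑ x, (u x - 4 * sZ (f x)) ^ 2 : ℤ) : ℝ) = 12288 := by exact_mod_cast hT12288
      rw [hbud] at h
      linarith
    have hScard' : #S = 256 := by
      have : (#S : ℤ) ≤ 256 := by linarith
      have : #S ≤ 256 := by exact_mod_cast this
      omega
    have hSsumeq : ∑ x ∈ S, X x = 4096 := by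
      apply le_antisymm (by rw [← hXeq]; exact hSsub)
      rw [hScard'] at hSsum; push_cast at hSsum; linarith
    -- split `Σ X = Σ_S X + Σ_{Sᶜ} X`
    have hsplit : ∑ x, X x = ∑ x ∈ S, X x + ∑ x ∈ univ.filter (fun x => x ∉ S), X x := by
      rw [← sum_filter_add_sum_filter_not univ (fun x => x ∈ S)]
      congr 1
      exact sum_congr (by ext x; simp) fun _ _ => rfl
    have hoff0 : ∑ x ∈ univ.filter (fun x => x ∉ S), X x = 0 := by linarith
    have hX0 : ∀ x, x ∉ S → X x = 0 := fun x hx =>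
      (sum_eq_zero_iff_of_nonneg fun y _ => hXnn y).1 hoff0 x (mem_filter.2 ⟨mem_univ _, hx⟩)
    -- on `S` every cost is exactly `16`
    have hX16 : ∀ x ∈ S, X x = 16 := by
      intro x hx
      by_contra hne
      have hgt : 17 ≤ X x := by have := hS16 x hx; omega
      have hrest : 16 * ((#S : ℤ) - 1) ≤ ∑ y ∈ S.erase x, X y := by
        have h := hXset (S.erase x) 1 le_rfl (fun y hy => by
          obtain ⟨k, hk⟩ := (mem_filter.1 (mem_of_mem_erase hy)).2; omega)
        rw [card_erase_of_mem hx] at h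
        have hc : ((#S - 1 : ℕ) : ℤ) = (#S : ℤ) - 1 := by
          have : 1 ≤ #S := by rw [hScard']; norm_num
          push_cast [Nat.cast_sub this]; ring
        rw [hc] at h
        linarith
      have := Finset.sum_erase_add S X hx
      rw [hScard'] at hrest
      push_cast at hrest
      linarith
    refine ⟨hΦeq, v, hvx, fun x => ?_, ?_⟩
    · by_cases hx : x ∈ S
      · right
        have hodd : Odd (v x) := (mem_filter.1 hx).2
        have h16 := hX16 x hx
        simp only [X] at h16
        -- `64v² + 16τ₀v = 16` with `v` odd and `|τ₀| ≤ 3` forces `v = ±1`, `τ₀ = −3v`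
        have hv1 : v x = 1 ∨ v x = -1 := by
          have ht : -3 ≤ τ₀ x ∧ τ₀ x ≤ 3 := by rcases hτ₀val x with h | h | h | h <;> rw [h] <;> norm_num
          have h2 : ¬ (2 ≤ v x) := fun h2 => by
            nlinarith [mul_nonneg (sub_nonneg.2 h2) (by linarith : (0:ℤ) ≤ τ₀ x + 3), mul_nonneg (sub_nonneg.2 h2) (sub_nonneg.2 h2)]
          have h3 : ¬ (v x ≤ -2) := fun h3 => by
            nlinarith [mul_nonneg (by linarith : (0:ℤ) ≤ -2 - v x) (by linarith : (0:ℤ) ≤ 3 - τ₀ x),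
              mul_nonneg (by linarith : (0:ℤ) ≤ -2 - v x) (by linarith : (0:ℤ) ≤ -2 - v x)]
          have h0 := Int.odd_iff.1 hodd
          omega
        refine ⟨hv1, ?_⟩
        change τ₀ x = -3 * v x
        rcases hv1 with h1 | h1 <;> rw [h1] at h16 ⊢ <;> rcases hτ₀val x with h | h | h | h <;> rw [h] at h16 ⊢ <;>
          norm_num at h16 <;> norm_num
      · left
        have hev : Even (v x) := Int.not_odd_iff_even.1 fun h => hx (mem_filter.2 ⟨mem_univ _, h⟩)
        have h0 := hX0 x hx
        simp only [X] at h0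
        by_contra hne
        have h2 : 2 ≤ v x ∨ v x ≤ -2 := by obtain ⟨k, hk⟩ := hev; omega
        have := to12_excess _ _ 2 (hτ₀val x) (by norm_num) h2
        linarith
    · -- the wild points are exactly the odd points
      have hset : (univ.filter fun x => v x ≠ 0) = S := by
        apply filter_congr
        intro x _
        constructor
        · intro hne
          by_contra hx
          have hev : Even (v x) := Int.not_odd_iff_even.1 hx
          have h0 := hX0 x (fun h => hx (mem_filter.1 h).2)
          simp only [X] at h0
          have h2 : 2 ≤ v x ∨ v x ≤ -2 := by obtain ⟨k, hk⟩ := hev; omega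
          have := to12_excess _ _ 2 (hτ₀val x) (by norm_num) h2
          linarith
        · intro hodd h0
          rw [h0] at hodd
          exact absurd hodd (by decide)
      rw [hset, hScard']

/-- **The 9-flat base pattern is dead in the open window `29/32 < Φ < 929/1024`** (type O, `#E = 512`, 12 bits).  NOT summit progress.
[this work] -/
theorem to22_typeO_E512_lt929_false (f g : (Fin (6 + 6) → Bool) → Bool) (hf : IsDegLeFun 3 f) (hg : IsDegLeFun 3 g)
    (u : (Fin (6 + 6) → Bool) → ℤ) (hu : ∀ x, W (fun y => signOf (g y)) x = (2 : ℝ) ^ 4 * (u x : ℝ))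
    (hodd : ∃ x, Odd (u x)) (hE512 : #(univ.filter fun x : Fin (6 + 6) → Bool => (Odd (u x / 2) ↔ Odd (u x / 2 / 2))) = 512)
    (hΦ : (29 / 32 : ℝ) < forrelation f g) (hhi : forrelation f g < 929 / 1024) : False := by
  rcases to22_typeO_E512_ge2932_dichotomy f g hf hg u hu hodd hE512 hΦ.le with h929 | ⟨hΦeq, -⟩
  · linarith
  · rw [hΦeq] at hΦ; exact lt_irrefl _ hΦ

/-- **The 9-flat base pattern is dead at every `Φ > 29/32`** (with `to20_typeO_E512_ge929_false` for `Φ ≥ 929/1024`).  Equivalently a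
type-O side with `#E = 512` has `Φ ≤ 29/32` (gen 19: `≤ 929/1024`).  NOT summit progress. [this work] -/
theorem to22_typeO_E512_gt2932_false (f g : (Fin (6 + 6) → Bool) → Bool) (hf : IsDegLeFun 3 f) (hg : IsDegLeFun 3 g)
    (u : (Fin (6 + 6) → Bool) → ℤ) (hu : ∀ x, W (fun y => signOf (g y)) x = (2 : ℝ) ^ 4 * (u x : ℝ))
    (hodd : ∃ x, Odd (u x)) (hE512 : #(univ.filter fun x : Fin (6 + 6) → Bool => (Odd (u x / 2) ↔ Odd (u x / 2 / 2))) = 512)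
    (hΦ : (29 / 32 : ℝ) < forrelation f g) : False := by
  by_cases h929 : (929 / 1024 : ℝ) ≤ forrelation f g
  · exact to20_typeO_E512_ge929_false f g hf hg u hu hodd hE512 h929
  · push Not at h929
    exact to22_typeO_E512_lt929_false f g hf hg u hu hodd hE512 hΦ h929

/-- **A type-O side with the 9-flat base pattern has `Φ ≤ 29/32`** (12 bits).  NOT summit progress. [this work] -/
theorem to22_typeO_E512_le_2932 (f g : (Fin (6 + 6) → Bool) → Bool) (hf : IsDegLeFun 3 f) (hg : IsDegLeFun 3 g)
    (u : (Fin (6 + 6) → Bool) → ℤ) (hu : ∀ x, W (fun y => signOf (g y)) x = (2 : ℝ) ^ 4 * (u x : ℝ))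
    (hodd : ∃ x, Odd (u x)) (hE512 : #(univ.filter fun x : Fin (6 + 6) → Bool => (Odd (u x / 2) ↔ Odd (u x / 2 / 2))) = 512) :
    forrelation f g ≤ 29 / 32 := by
  by_contra h
  push Not at h
  exact to22_typeO_E512_gt2932_false f g hf hg u hu hodd hE512 h

end Summit.QuantumAdvantage.QuantumAdvantage.Theorems.CubicForrelation.NearExactIsExact

end
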